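import Literature.NumberTheory.Sieve.PolymathGEHLambdaConst
import Mathlib.Data.Nat.Choose.Sum
import HarnessLib

/-!
# The binomial model of `λ_F` with designated top primes

Trunk AntSieve, tooling toward the named fact `Literature.NumberTheory.Sieve.weakDHL_three_two_of_GEH`
(D. H. J. Polymath, Res. Math. Sci. 1:12 (2014) = arXiv:1407.4897, Theorem 3.2(xii)).  Companion of
`PolymathGEHLambdaConst` for the `Σ₃` step of Theorem 3.6(ii) (§4.5, p. 17).  When the prime
factors of a square-free `n` split as `S ⊔ T` with the primes of `T` (those of the top range) all
assigned the same model logarithm `u`, the model value `lambdaModel F u' n` only depends on `S`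
(with its logarithms) and `t = #T`:
`lambdaModel F u' n = Σ_{S' ⊆ S} Σ_{i=0}^{t} (−1)^{#S'+i} C(t, i) F(Σ_{q∈S'} u' q + i u)`
(`lambdaModel_eq_phiModel`), the binomial model `phiModel` — this is the value the `α`-side of the
layered decomposition (`PolymathGEHLayered`) can compute from `n / p^e` and the layer `e` alone.
With `abs_divisorSumWeight_sub_lambdaModel_le` this gives
`|λ_F(n) − phiModel F S t u ℓ| ≤ 2^{ω(n)} D ω(n) η` whenever `|log_x p − u| ≤ η` on `T`
(`abs_divisorSumWeight_sub_phiModel_le`).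

## References

* [Polymath8b2014] D. H. J. Polymath, Res. Math. Sci. 1 (2014), Art. 12 = arXiv:1407.4897,
  §4.5, p. 17.
-/

noncomputable section

open Finset Real

namespace Literature.NumberTheory.Sieve

/-- The binomial model: `Σ_{S' ⊆ S} Σ_{i=0}^{t} (−1)^{#S'+i} C(t,i) F(Σ_{q ∈ S'} ℓ q + i u)`.
[cite: Polymath8b2014, §4.5, p. 17] -/
def phiModel (F : ℝ → ℝ) (S : Finset ℕ) (t : ℕ) (u : ℝ) (ℓ : ℕ → ℝ) : ℝ :=
  ∑ S' ∈ S.powerset, ∑ i ∈ range (t + 1), (-1 : ℝ) ^ (#S' + i) * (t.choose i : ℝ) * F (∑ q ∈ S', ℓ q + i * u)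

/-- Sums over the power set of a disjoint union split as double sums. [folklore] -/
theorem sum_powerset_union_of_disjoint {S T : Finset ℕ} (hST : Disjoint S T) (g : Finset ℕ → ℝ) :
    ∑ R ∈ (S ∪ T).powerset, g R = ∑ S' ∈ S.powerset, ∑ T' ∈ T.powerset, g (S' ∪ T') := by
  have hsplit : ∀ R ∈ (S ∪ T).powerset, R ∩ S ∪ R ∩ T = R := by
    intro R hR
    rw [Finset.mem_powerset] at hR
    rw [← Finset.inter_union_distrib_left, Finset.inter_eq_left.2 hR]
  rw [← Finset.sum_product']
  refine Finset.sum_bij' (fun R _ => (R ∩ S, R ∩ T)) (fun ST _ => ST.1 ∪ ST.2) ?_ ?_ ?_ ?_ ?_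
  · intro R _
    rw [Finset.mem_product, Finset.mem_powerset, Finset.mem_powerset]
    exact ⟨Finset.inter_subset_right, Finset.inter_subset_right⟩
  · intro ST hST'
    rw [Finset.mem_product, Finset.mem_powerset, Finset.mem_powerset] at hST'
    rw [Finset.mem_powerset]
    exact Finset.union_subset_union hST'.1 hST'.2
  · intro R hR
    exact hsplit R hR
  · intro ST hST'
    rw [Finset.mem_product, Finset.mem_powerset, Finset.mem_powerset] at hST'
    obtain ⟨h1, h2⟩ := hST'
    have e1 : (ST.1 ∪ ST.2) ∩ S = ST.1 := by
      rw [Finset.union_inter_distrib_right, Finset.inter_eq_left.2 h1,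
        Finset.disjoint_iff_inter_eq_empty.1 (Finset.disjoint_of_subset_left h2 hST.symm), Finset.union_empty]
    have e2 : (ST.1 ∪ ST.2) ∩ T = ST.2 := by
      rw [Finset.union_inter_distrib_right, Finset.inter_eq_left.2 h2,
        Finset.disjoint_iff_inter_eq_empty.1 (Finset.disjoint_of_subset_left h1 hST), Finset.empty_union]
    exact Prod.ext e1 e2
  · intro R hR
    rw [hsplit R hR]

/-- **The model with designated top primes is binomial**: if the prime factors of `n` are `S ⊔ T`,
`u' q = ℓ q` on `S` and `u' q = u` on `T`, then `lambdaModel F u' n = phiModel F S (#T) u ℓ`.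
[cite: Polymath8b2014, §4.5, p. 17] -/
theorem lambdaModel_eq_phiModel (F : ℝ → ℝ) {n : ℕ} {S T : Finset ℕ} (hST : Disjoint S T)
    (hn : n.primeFactors = S ∪ T) {u' ℓ : ℕ → ℝ} {u : ℝ} (hS : ∀ q ∈ S, u' q = ℓ q)
    (hT : ∀ q ∈ T, u' q = u) : lambdaModel F u' n = phiModel F S (#T) u ℓ := by
  unfold lambdaModel phiModel
  rw [hn, sum_powerset_union_of_disjoint hST]
  refine Finset.sum_congr rfl fun S' hS' => ?_
  have hS'S := Finset.mem_powerset.1 hS'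
  -- for fixed `S'`, the inner sum over `T' ⊆ T` depends only on `#T'`
  have hinner : ∀ T' ∈ T.powerset, (-1 : ℝ) ^ #(S' ∪ T') * F (∑ q ∈ S' ∪ T', u' q) =
      (fun i : ℕ => (-1 : ℝ) ^ (#S' + i) * F (∑ q ∈ S', ℓ q + i * u)) #T' := by
    intro T' hT'
    have hT'T := Finset.mem_powerset.1 hT'
    have hdisj : Disjoint S' T' := Finset.disjoint_of_subset_left hS'S (Finset.disjoint_of_subset_right hT'T hST)
    simp only
    rw [Finset.card_union_of_disjoint hdisj, Finset.sum_union hdisj]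
    congr 2
    rw [Finset.sum_congr rfl fun q hq => hS q (hS'S hq), Finset.sum_congr rfl fun q hq => hT q (hT'T hq),
      Finset.sum_const, nsmul_eq_mul]
  rw [Finset.sum_congr rfl hinner,
    Finset.sum_powerset_apply_card (fun i : ℕ => (-1 : ℝ) ^ (#S' + i) * F (∑ q ∈ S', ℓ q + i * u))]
  refine Finset.sum_congr rfl fun i _ => ?_
  rw [nsmul_eq_mul]; ring

/-- **`λ_F` against the binomial model**: `F` differentiable with `|F'| ≤ D`, `n` square-free with
prime factors `S ⊔ T`, `ℓ q = log q / log x`, and `|ℓ p − u| ≤ η` for `p ∈ T` (`η ≥ 0`); then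
`|λ_F(n) − phiModel F S (#T) u ℓ| ≤ 2^{ω(n)} D ω(n) η`. [cite: Polymath8b2014, §4.5, p. 17] -/
theorem abs_divisorSumWeight_sub_phiModel_le {F : ℝ → ℝ} (hF : Differentiable ℝ F) {D : ℝ}
    (hD : ∀ t, |deriv F t| ≤ D) (x : ℝ) {n : ℕ} (hn : Squarefree n) {S T : Finset ℕ}
    (hST : Disjoint S T) (hpf : n.primeFactors = S ∪ T) {u η : ℝ} (hη : 0 ≤ η)
    (hu : ∀ p ∈ T, |Real.log p / Real.log x - u| ≤ η) :
    |divisorSumWeight F x n - phiModel F S (#T) u (fun q => Real.log q / Real.log x)| ≤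
      2 ^ n.primeFactors.card * (D * (n.primeFactors.card * η)) := by
  classical
  set u' : ℕ → ℝ := fun q => if q ∈ T then u else Real.log q / Real.log x with hu'
  have h1 := abs_divisorSumWeight_sub_lambdaModel_le hF hD x hn u' (η := η) (fun p hp => by
    rw [hu']; simp only
    split_ifs with hpT
    · exact hu p hpT
    · rw [sub_self, abs_zero]; exact hη)
  rwa [lambdaModel_eq_phiModel F hST hpf (u' := u') (ℓ := fun q => Real.log q / Real.log x) (u := u)
    (fun q hq => by rw [hu']; simp only; rw [if_neg (Finset.disjoint_left.1 hST hq)])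
    (fun q hq => by rw [hu']; simp only; rw [if_pos hq])] at h1

end Literature.NumberTheory.Sieve
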